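import Mathlib
import Summits.Ventures.PercRepro.TriangleCapTriangleFreeTwoB
import Summits.Ventures.PercRepro.TriangleCapTriangleFreeThreeA

/-!
# PercRepro — THREE BELOW THE DIAGONAL ON TRIANGLE-FREE GRAPHS, PART B: the arithmetic of the cases and the case
`|Z| = 1` (p3, gen 36; part 41)

* `arith_star` — the star bound inside `X × Y` with `N₁ ≥ 2` missing pairs gives `2 (|X| + |Y|) ≤ Σ + 8`;
* `arith_Z1_one` — the case `|Z| = 1`, one missing pair, `z` with exactly one neighbour on each side;
* `arith_Z2` — the case `|Z| = 2` with all `X`–`Y` pairs adjacent, `z₁ ~ z₂` on the same side;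
* **`core_Z1`** — `|Z| = 1`: `6 (k − 4) ≤ 2 Σ_{A₁} + 2 Σ_{A₃} + Σ_{A₅}`.
Axioms: standard.
-/

namespace PercRepro

namespace TriangleCap

namespace C047

open Finset

variable {V : Type*} [Fintype V] [DecidableEq V]

/-- `max(N (s − 1 − N), 2N) ≥ 2s − 8` for `N ≥ 2`. -/
theorem arith_star (N s S : ℕ) (hN : 2 ≤ N) (h1 : N * (s - 1 - N) ≤ S) (h2 : 2 * N ≤ S) : 2 * s ≤ S + 8 := by
  by_cases hs : s ≤ N + 4
  · omega
  · obtain ⟨N', hN'⟩ : ∃ N', N = N' + 2 := ⟨N - 2, by omega⟩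
    obtain ⟨j, hj⟩ : ∃ j, s = N' + 7 + j := ⟨s - N' - 7, by omega⟩
    subst hN' hj
    have e : N' + 7 + j - 1 - (N' + 2) = j + 4 := by omega
    rw [e] at h1
    nlinarith

/-- The case `|Z| = 1` with one missing pair: `z` has one neighbour on each side, `a = |X| − 1 ≥ 1`,
`b = |Y| − 1 ≥ 3`. -/
theorem arith_Z1_one (a b S f e A1 A5 : ℕ) (ha : 1 ≤ a) (hb : 3 ≤ b) (hS : a + b ≤ S) (hf : a * b ≤ f + 1)
    (he : a + b ≤ e) (hA1 : S + f ≤ A1) : 6 * (a + b - 1) ≤ 2 * A1 + 2 * e + A5 := by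
  obtain ⟨a', ha'⟩ : ∃ a', a = a' + 1 := ⟨a - 1, by omega⟩
  obtain ⟨b', hb'⟩ : ∃ b', b = b' + 3 := ⟨b - 3, by omega⟩
  subst ha' hb'
  have e1 : a' + 1 + (b' + 3) - 1 = a' + b' + 3 := by omega
  rw [e1]
  nlinarith [Nat.zero_le (a' * b')]

/-- `arith_Z2` with the sides exchanged: the `z`'s neighbours on the side of size `q ≥ 4`, the other side `p ≥ 1`. -/
theorem arith_Z2_swap (q s₁ s₂ b₁ b₂ p : ℕ) (h1 : s₁ + b₁ = q) (h2 : s₂ + b₂ = q) (hs₁ : 1 ≤ s₁) (hs₂ : 1 ≤ s₂)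
    (hdisj : s₁ + s₂ ≤ q) (hq : 4 ≤ q) (hp : 1 ≤ p) :
    6 * (q + p - 2) ≤ 2 * (b₁ * p + b₂ * p) + 2 * (s₁ * b₁ + s₂ * b₂) + 2 * p := by
  obtain ⟨u₁, hu₁⟩ : ∃ u, s₁ = u + 1 := ⟨s₁ - 1, by omega⟩
  obtain ⟨u₂, hu₂⟩ : ∃ u, s₂ = u + 1 := ⟨s₂ - 1, by omega⟩
  obtain ⟨c, hc⟩ : ∃ c, q = u₁ + u₂ + 2 + c := ⟨q - u₁ - u₂ - 2, by omega⟩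
  obtain ⟨p', hp'⟩ : ∃ p', p = p' + 1 := ⟨p - 1, by omega⟩
  have hb₁ : b₁ = u₂ + 1 + c := by omega
  have hb₂ : b₂ = u₁ + 1 + c := by omega
  subst hu₁ hu₂ hp'
  rw [hb₁, hb₂, hc]
  have e : u₁ + u₂ + 2 + c + (p' + 1) - 2 = u₁ + u₂ + c + p' + 1 := by omega
  rw [e]
  nlinarith [Nat.zero_le (u₁ * u₂), Nat.zero_le (c * u₁), Nat.zero_le (c * u₂), Nat.zero_le (u₁ * p'),
    Nat.zero_le (u₂ * p'), Nat.zero_le (c * p')]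

/-- `t s ≥ 1` with `t s ≤ 1` forces `t = s = 1`. -/
theorem eq_one_of_mul_le_one (t s : ℕ) (ht : 1 ≤ t) (hs : 1 ≤ s) (h : t * s ≤ 1) : t = 1 ∧ s = 1 := by
  constructor <;> nlinarith

/-- `N = 0` contradicts `t s ≥ 1`. -/
theorem one_le_of_mul (t s N : ℕ) (ht : 1 ≤ t) (hs : 1 ≤ s) (h : t * s ≤ N) : 1 ≤ N := by
  nlinarith

/-- The case `|Z| = 2`, all `X`–`Y` pairs adjacent, `z₁ ~ z₂` with neighbours `t₁, t₂ ≥ 1` on one side of size `p`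
(disjoint: `t₁ + t₂ ≤ p`), the other side of size `Y ≥ 4`. -/
theorem arith_Z2 (p t₁ t₂ a₁ a₂ Y : ℕ) (h1 : t₁ + a₁ = p) (h2 : t₂ + a₂ = p) (ht₁ : 1 ≤ t₁) (ht₂ : 1 ≤ t₂)
    (hdisj : t₁ + t₂ ≤ p) (hY : 4 ≤ Y) :
    6 * (p + Y - 2) ≤ 2 * (a₁ * Y + a₂ * Y) + 2 * (t₁ * a₁ + t₂ * a₂) + 2 * Y := by
  obtain ⟨u₁, hu₁⟩ : ∃ u, t₁ = u + 1 := ⟨t₁ - 1, by omega⟩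
  obtain ⟨u₂, hu₂⟩ : ∃ u, t₂ = u + 1 := ⟨t₂ - 1, by omega⟩
  obtain ⟨c, hc⟩ : ∃ c, p = u₁ + u₂ + 2 + c := ⟨p - u₁ - u₂ - 2, by omega⟩
  obtain ⟨q, hq⟩ : ∃ q, Y = q + 4 := ⟨Y - 4, by omega⟩
  have ha₁ : a₁ = u₂ + 1 + c := by omega
  have ha₂ : a₂ = u₁ + 1 + c := by omega
  subst hu₁ hu₂ hq
  rw [ha₁, ha₂, hc]
  have e : u₁ + u₂ + 2 + c + (q + 4) - 2 = u₁ + u₂ + c + q + 4 := by omega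
  rw [e]
  nlinarith [Nat.zero_le (u₁ * u₂), Nat.zero_le (c * u₁), Nat.zero_le (c * u₂), Nat.zero_le (u₁ * q),
    Nat.zero_le (u₂ * q), Nat.zero_le (c * q)]

/-- **THE CASE `|Z| = 1`** of the `r = 3` core: with `z` the vertex of `Z`, not bipartite spanning, `|Y| ≥ 4`. -/
theorem core_Z1 (D : SimpleGraph V) [DecidableRel D.Adj]
    (htri : ∀ a b c, D.Adj a b → D.Adj a c → D.Adj b c → False) {u v : V} (huv : D.Adj u v)
    (X Y Z : Finset V) (memX : ∀ w, w ∈ X ↔ D.Adj v w) (memY : ∀ w, w ∈ Y ↔ D.Adj u w)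
    (memZ : ∀ w, w ∈ Z ↔ ¬ D.Adj v w ∧ ¬ D.Adj u w)
    (A₁ A₃ A₅ : Finset (V × V)) (memA₁ : ∀ p, p ∈ A₁ ↔ D.Adj p.1 p.2 ∧ D.Adj v p.1 ∧ D.Adj u p.2)
    (memA₃ : ∀ p, p ∈ A₃ ↔ D.Adj p.1 p.2 ∧ (¬ D.Adj v p.1 ∧ ¬ D.Adj u p.1) ∧ (D.Adj v p.2 ∨ D.Adj u p.2))
    (hA1sum : ∑ p ∈ A₁, (X.filter (fun w => ¬ D.Adj p.2 w)).card +
      ∑ p ∈ A₁, (Y.filter (fun w => ¬ D.Adj p.1 w)).card +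
        ∑ p ∈ A₁, (Z.filter (fun w => ¬ D.Adj p.1 w ∧ ¬ D.Adj p.2 w)).card ≤ ∑ p ∈ A₁, deficit D p)
    (hnb : ¬ ∃ A : Finset V, ∀ x y, D.Adj x y → (x ∈ A ↔ y ∉ A))
    (hY4 : 4 ≤ Y.card) (hZ1 : Z.card = 1) :
    6 * (X.card + Y.card + Z.card - 4) ≤ 2 * ∑ p ∈ A₁, deficit D p + 2 * ∑ p ∈ A₃, deficit D p +
      ∑ p ∈ A₅, deficit D p := by
  have huX : u ∈ X := (memX u).mpr huv.symm
  have hvY : v ∈ Y := (memY v).mpr huv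
  obtain ⟨z, hzZ⟩ : ∃ z, z ∈ Z := card_pos.mp (by omega)
  have hZeq : Z = {z} := by
    rw [card_eq_one] at hZ1
    obtain ⟨a, ha⟩ := hZ1
    rw [ha, mem_singleton] at hzZ
    rw [ha, hzZ]
  have hz' := (memZ z).mp hzZ
  have hclass : ∀ w, D.Adj v w ∨ D.Adj u w ∨ w = z := by
    intro w
    by_cases h1 : D.Adj v w
    · exact Or.inl h1
    by_cases h2 : D.Adj u w
    · exact Or.inr (Or.inl h2)
    have hw : w ∈ Z := (memZ w).mpr ⟨h1, h2⟩
    rw [hZeq, mem_singleton] at hw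
    exact Or.inr (Or.inr hw)
  -- `z` has a neighbour on each side
  have ht1 : 1 ≤ (X.filter (fun x => D.Adj z x)).card := by
    by_contra h
    apply hnb
    apply bipartite_of_Z_singleton_noX D htri (u := u) X Y memX memY hclass
    intro x hx hzx
    exact h (card_pos.mpr ⟨x, mem_filter.mpr ⟨hx, hzx⟩⟩)
  have hs1 : 1 ≤ (Y.filter (fun y => D.Adj z y)).card := by
    by_contra h
    apply hnb
    apply bipartite_of_Z_singleton_noY D htri (u := u) X Y memX memY hclass
    intro y hy hzy
    exact h (card_pos.mpr ⟨y, mem_filter.mpr ⟨hy, hzy⟩⟩)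
  have hts := mul_nbrs_le_missing D htri X Y z
  have hXc := card_filter_add_card_filter_not (s := X) (fun w => D.Adj z w)
  have hYc := card_filter_add_card_filter_not (s := Y) (fun w => D.Adj z w)
  -- the sums over `Z = {z}`
  have hfarZ : ∑ p ∈ A₁, (Z.filter (fun w => ¬ D.Adj p.1 w ∧ ¬ D.Adj p.2 w)).card =
      (A₁.filter (fun p => ¬ D.Adj p.1 z ∧ ¬ D.Adj p.2 z)).card := by
    simp only [card_filter]
    rw [sum_comm, hZeq, sum_singleton]
  have hA3sum := edges_at_Z_lower D htri huv X Y Z memX memY memZ A₃ memA₃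
  rw [hZeq, sum_singleton] at hA3sum
  rw [hfarZ] at hA1sum
  have hprod := far_pairs_product_lower D X Y memX memY A₁ memA₁ z
  have hfar1 := far_pairs_lower D huv X Y memX memY A₁ memA₁ hz'.1 hz'.2
  have hstar := xy_star_lower D X Y memX memY A₁ memA₁
  have h2N := two_mul_missing_le D huv X Y memX memY A₁ memA₁
  rw [hZ1]
  -- atoms
  have ha1 : 1 ≤ (X.filter (fun x => ¬ D.Adj z x)).card :=
    card_pos.mpr ⟨u, by rw [mem_filter]; exact ⟨huX, fun h => hz'.2 h.symm⟩⟩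
  have hzpart := per_z_arith D X Y huX hvY hz'.1 hz'.2
  set t := (X.filter (fun w => D.Adj z w)).card with ht
  set s := (Y.filter (fun w => D.Adj z w)).card with hs
  set a := (X.filter (fun x => ¬ D.Adj z x)).card with ha
  set b := (Y.filter (fun y => ¬ D.Adj z y)).card with hb
  set N := (missing D X Y).card with hN
  set f := (A₁.filter (fun p => ¬ D.Adj p.1 z ∧ ¬ D.Adj p.2 z)).card with hf
  set S := ∑ p ∈ A₁, (X.filter (fun w => ¬ D.Adj p.2 w)).card +
      ∑ p ∈ A₁, (Y.filter (fun w => ¬ D.Adj p.1 w)).card with hS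
  by_cases hN1 : N ≤ 1
  · -- one missing pair: `t = s = 1`
    have hN1' : N = 1 := by
      have := one_le_of_mul t s N ht1 hs1 hts
      omega
    rw [hN1'] at hts hprod
    obtain ⟨ht', hs'⟩ := eq_one_of_mul_le_one t s ht1 hs1 hts
    rw [ht'] at hXc hA3sum
    rw [hs'] at hYc hA3sum
    -- the pair count: `|X| + |Y| − 2 ≤ S`
    have hp : X.card + Y.card ≤ S + 2 := by
      obtain ⟨⟨x₀, y₀⟩, hm⟩ := card_pos.mp (show 0 < (missing D X Y).card by omega)
      unfold missing at hm
      rw [mem_filter, mem_product] at hm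
      have := xy_pair_lower D huv X Y memX memY A₁ memA₁ hm.1.1 hm.1.2 hm.2
      omega
    have hXa : X.card = a + 1 := by omega
    have hYb : Y.card = b + 1 := by omega
    rw [hXa, hYb]
    have e : a + 1 + (b + 1) + 1 - 4 = a + b - 1 := by omega
    rw [e]
    have harith := arith_Z1_one a b S f (1 * a + 1 * b) (∑ p ∈ A₁, deficit D p) (∑ p ∈ A₅, deficit D p)
      ha1 (by omega) (by omega) hprod (by omega) hA1sum
    omega
  · -- at least two missing pairs: the star bound inside `X × Y`
    have hN2 : 2 ≤ N := by omega
    have hstar' := arith_star N (X.card + Y.card) S hN2 hstar h2N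
    have e : X.card + Y.card + 1 - 4 = X.card + Y.card - 3 := by omega
    rw [e]
    omega

end C047

end TriangleCap

end PercRepro
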